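import Literature.Probability.Percolation.IntPairAsym
import Literature.Probability.Percolation.IntTermFenceUp
import HarnessLib

/-!
# The inner pair step with both explorations: fences from above, no double block (twin of `TrapPairUp.lean`)

Topic `Literature/Probability/Percolation`; family `crit-perc` / near-critical percolation on `𝕋`.
A brick of the INNER half of the near-critical arm-separation theorem for four arms in the ADJACENT
colour arrangement (P. Nolin, EJP 13 (2008), Thm. 11, `j = 4`, `σ = BBWW` [arXiv 0711.4948:
Thm. 10], §4.4 Lemma 15, internal extremities). Word-for-word twin of `TrapPairUp.lean`:
`IntPairDataB` (the asymmetric inner pair data together with the raw-good exploration FROM ABOVE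
of `intDom m`, middle tips), terms from above (`kOfUp`, `tipUp_mid`, `fenceUp : IntTermFenceUp`),
the enlarged admissible set `AsetB`, `ReachB`/`IsCutB`, the minimal term from above (`uMinUp`),
`route_c`, `route_d`, `exists_blocked_path`, `exists_exit_c`, `exists_exit_d`, `no_double_block`.

Everything here is proved; no named facts are introduced.

## References

* P. Nolin, Near-critical percolation in two dimensions, *Electron. J. Probab.* 13 (2008), §4.4,
  proof of Lemma 15, internal extremities (arXiv 0711.4948: Lemma 14) [Nolin2008].
* H. Kesten, *Percolation theory for mathematicians* (1982), §2.3 Prop. 2.3 [KestenPTM1982].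
-/

noncomputable section

open Set

namespace Literature.Probability.Percolation

open LatticeModels HalfAnnulus Literature.Combinatorics.SimpleGraph

/-- **The inner pair data with both explorations.** [cite: Nolin2008, §4.4 Lemma 15 (proof), internal extremities (arXiv 0711.4948: Lemma 14)] -/
structure IntPairDataB (m N k₀ K T T' R₀ : ℕ) (ω : SiteConfig (Site 2)) extends IntPairDataA m N k₀ K T R₀ ω where
  stopUp : (intDom m).flip.lowestSeq ω T' = none
  goodUp : ∀ u < T', ¬ IntSeqFailRawUp m u k₀ K ω
  midUp : ∀ (u : ℕ) (d : Finset (Site 2)) (z : Site 2), (intDom m).flip.lowestSeq ω u = some (d, z) → IntMidTip m R₀ z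

namespace IntPairDataB

open IntPairData (term_isCrossing term_open term_norm tip_isIntJ' term_eq)
open IntPairDataA (mem_J_of_isIntJ)

variable {m N k₀ K T T' R₀ : ℕ} {ω : SiteConfig (Site 2)}

/-! ### Terms from above -/

/-- Bookkeeping: `flip` has the cut property. [folklore] -/
theorem hcutUp (D : IntPairDataB m N k₀ K T T' R₀ ω) : (intDom m).flip.CutProp := JDomain.flip_cutProp D.hcut

/-- Bookkeeping: `flip` has the duality property. [folklore] -/
theorem hdualUp (D : IntPairDataB m N k₀ K T T' R₀ ω) : (intDom m).flip.DualProp :=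
  JDomain.flip_dualProp D.toIntPairDataA.hdual

/-- A term from above exists only below the stopping index. [folklore] -/
theorem ltUp_of_some (D : IntPairDataB m N k₀ K T T' R₀ ω) {u : ℕ} {d : Finset (Site 2)} {z : Site 2}
    (hu : (intDom m).flip.lowestSeq ω u = some (d, z)) : u < T' := by
  by_contra h
  rw [JDomain.lowestSeq_eq_none_of_le D.stopUp (not_lt.1 h)] at hu
  exact absurd hu (by simp)

/-- A term from above is a crossing of the half-annulus domain. [folklore] -/
theorem termUp_isCrossing {u : ℕ} {d : Finset (Site 2)} {z : Site 2}
    (hu : (intDom m).flip.lowestSeq ω u = some (d, z)) : (intDom m).IsCrossing d z :=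
  (JDomain.flip_isCrossing_iff _).1 (JDomain.isCrossing_of_lowestSeq hu).1

/-- A term from above is a crossing of the flipped domain. [folklore] -/
theorem termUp_isCrossing' {u : ℕ} {d : Finset (Site 2)} {z : Site 2}
    (hu : (intDom m).flip.lowestSeq ω u = some (d, z)) : (intDom m).flip.IsCrossing d z :=
  (JDomain.isCrossing_of_lowestSeq hu).1

/-- A term from above is open. [folklore] -/
theorem termUp_open {u : ℕ} {d : Finset (Site 2)} {z : Site 2}
    (hu : (intDom m).flip.lowestSeq ω u = some (d, z)) : (↑d : Set (Site 2)) ⊆ ω :=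
  (JDomain.isCrossing_of_lowestSeq hu).2

/-- The index of a raw-good scale of a term from above. [folklore] -/
def jOfUp (D : IntPairDataB m N k₀ K T T' R₀ ω) {u : ℕ} {d : Finset (Site 2)} {z : Site 2}
    (hu : (intDom m).flip.lowestSeq ω u = some (d, z)) : ℕ :=
  Classical.choose (exists_intRawOKUp_of_not_fail (D.goodUp u (D.ltUp_of_some hu)) hu)

/-- Bookkeeping (`jOfUp_spec`). [folklore] -/
theorem jOfUp_spec (D : IntPairDataB m N k₀ K T T' R₀ ω) {u : ℕ} {d : Finset (Site 2)} {z : Site 2}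
    (hu : (intDom m).flip.lowestSeq ω u = some (d, z)) :
    D.jOfUp hu < K ∧ IntRawOKUp m d z (trapScale k₀ (D.jOfUp hu)) ω :=
  Classical.choose_spec (exists_intRawOKUp_of_not_fail (D.goodUp u (D.ltUp_of_some hu)) hu)

/-- The raw-good scale of a term from above. [folklore] -/
def kOfUp (D : IntPairDataB m N k₀ K T T' R₀ ω) {u : ℕ} {d : Finset (Site 2)} {z : Site 2}
    (hu : (intDom m).flip.lowestSeq ω u = some (d, z)) : ℕ :=
  trapScale k₀ (D.jOfUp hu)

/-- Bookkeeping (`rawUp`). [folklore] -/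
theorem rawUp (D : IntPairDataB m N k₀ K T T' R₀ ω) {u : ℕ} {d : Finset (Site 2)} {z : Site 2}
    (hu : (intDom m).flip.lowestSeq ω u = some (d, z)) : IntRawOKUp m d z (D.kOfUp hu) ω := (D.jOfUp_spec hu).2

/-- Bookkeeping (`one_le_kOfUp`). [folklore] -/
theorem one_le_kOfUp (D : IntPairDataB m N k₀ K T T' R₀ ω) {u : ℕ} {d : Finset (Site 2)} {z : Site 2}
    (hu : (intDom m).flip.lowestSeq ω u = some (d, z)) : 1 ≤ D.kOfUp hu :=
  one_le_trapScale (by have := D.hk₀; omega) _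

/-- Bookkeeping (`two_le_kOfUp`). [folklore] -/
theorem two_le_kOfUp (D : IntPairDataB m N k₀ K T T' R₀ ω) {u : ℕ} {d : Finset (Site 2)} {z : Site 2}
    (hu : (intDom m).flip.lowestSeq ω u = some (d, z)) : 2 ≤ D.kOfUp hu :=
  Nat.mul_le_mul D.hk₀ (Nat.one_le_pow _ _ (by norm_num))

/-- Bookkeeping (`kOfUp_lt`). [folklore] -/
theorem kOfUp_lt (D : IntPairDataB m N k₀ K T T' R₀ ω) {u : ℕ} {d : Finset (Site 2)} {z : Site 2}
    (hu : (intDom m).flip.lowestSeq ω u = some (d, z)) : 4 * (16 * D.kOfUp hu) < m :=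
  D.hKm _ (D.jOfUp_spec hu).1

/-- Middle tip of a term from above, at its own scale. [folklore] -/
theorem tipUp_mid (D : IntPairDataB m N k₀ K T T' R₀ ω) {u : ℕ} {d : Finset (Site 2)} {z : Site 2}
    (hu : (intDom m).flip.lowestSeq ω u = some (d, z)) :
    -(m : ℤ) + 32 * D.kOfUp hu + 1 ≤ z 1 ∧ z 1 ≤ -(32 * (D.kOfUp hu : ℤ) + 1) := by
  have h1 := D.midUp u d z hu
  have h2 := D.hKR _ (D.jOfUp_spec hu).1
  unfold IntMidTip at h1
  have h3 : (32 * trapScale k₀ (D.jOfUp hu) + 1 : ℕ) ≤ (R₀ : ℤ) := by exact_mod_cast h2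
  push_cast at h3
  change -(m : ℤ) + 32 * (trapScale k₀ (D.jOfUp hu) : ℤ) + 1 ≤ z 1 ∧ z 1 ≤ -(32 * (trapScale k₀ (D.jOfUp hu) : ℤ) + 1)
  omega

/-- The tip of a term from above lies on the inner tip arc. [folklore] -/
theorem tipUp_isIntJ {u : ℕ} {d : Finset (Site 2)} {z : Site 2} (hu : (intDom m).flip.lowestSeq ω u = some (d, z)) : IsIntJ m z :=
  Literature.Probability.Percolation.tip_isIntJ (termUp_isCrossing hu)

/-- Bookkeeping (`S_norm_geUp`). [folklore] -/
theorem S_norm_geUp (D : IntPairDataB m N k₀ K T T' R₀ ω) {u : ℕ} {d : Finset (Site 2)} {z : Site 2}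
    (hu : (intDom m).flip.lowestSeq ω u = some (d, z)) : ∀ v ∈ D.S d, (m : ℤ) ≤ triNorm v := by
  rintro v (hv | hv)
  · exact (mem_haFin.1 ((termUp_isCrossing hu).subset (Finset.mem_coe.1 hv))).2.1
  · exact D.armSet_norm_ge hv

/-- **The inner fence of a term from above, stopped at `d ∪ (arms)`.** [cite: Nolin2008, §4.4 Lemma 15 (proof), internal extremities (arXiv 0711.4948: Lemma 14)] -/
def fenceUp (D : IntPairDataB m N k₀ K T T' R₀ ω) {u : ℕ} {d : Finset (Site 2)} {z : Site 2}
    (hu : (intDom m).flip.lowestSeq ω u = some (d, z)) : IntTermFenceUp m d z (D.kOfUp hu) ω (D.S d) :=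
  Classical.choice ((D.rawUp hu).nonempty_intTermFenceUp D.hm (D.one_le_kOfUp hu) (termUp_isCrossing' hu)
    (by have := D.tipUp_mid hu; omega) (D.c_subset_S d) (D.S_norm_geUp hu))

/-- **The admissible sites with both explorations**: the arms, the terms from below with their
fence connections, the terms from above with theirs. [cite: Nolin2008, §4.4 Lemma 15 (proof) (arXiv 0711.4948: Lemma 14)] -/
def AsetB (D : IntPairDataB m N k₀ K T T' R₀ ω) : Set (Site 2) :=
  D.Aset ∪ {v | ∃ (u : ℕ) (d : Finset (Site 2)) (z : Site 2) (hu : (intDom m).flip.lowestSeq ω u = some (d, z)),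
    v ∈ (↑d : Set (Site 2)) ∨ v ∈ (D.fenceUp hu).F}

/-- **The targets with both explorations.** [cite: Nolin2008, §4.4 Lemma 15 (proof) (arXiv 0711.4948: Lemma 14)] -/
def TsetB (D : IntPairDataB m N k₀ K T T' R₀ ω) : Set (Site 2) :=
  D.Tset ∪ {v | ∃ (u : ℕ) (d : Finset (Site 2)) (z : Site 2) (hu : (intDom m).flip.lowestSeq ω u = some (d, z)),
    v = (D.fenceUp hu).m'}

/-- Bookkeeping (`Aset_subset_AsetB`). [folklore] -/
theorem Aset_subset_AsetB (D : IntPairDataB m N k₀ K T T' R₀ ω) : D.Aset ⊆ D.AsetB := Set.subset_union_left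

/-- Bookkeeping (`termUp_subset_AsetB`). [folklore] -/
theorem termUp_subset_AsetB (D : IntPairDataB m N k₀ K T T' R₀ ω) {u : ℕ} {d : Finset (Site 2)} {z : Site 2}
    (hu : (intDom m).flip.lowestSeq ω u = some (d, z)) : (↑d : Set (Site 2)) ⊆ D.AsetB :=
  fun _ hv => Or.inr ⟨u, d, z, hu, Or.inl hv⟩

/-- Bookkeeping (`fenceUp_subset_AsetB`). [folklore] -/
theorem fenceUp_subset_AsetB (D : IntPairDataB m N k₀ K T T' R₀ ω) {u : ℕ} {d : Finset (Site 2)} {z : Site 2}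
    (hu : (intDom m).flip.lowestSeq ω u = some (d, z)) : (D.fenceUp hu).F ⊆ D.AsetB :=
  fun _ hv => Or.inr ⟨u, d, z, hu, Or.inr hv⟩

/-- The admissible sites are open. [folklore] -/
theorem AsetB_subset (D : IntPairDataB m N k₀ K T T' R₀ ω) : D.AsetB ⊆ ω := by
  rintro v (hv | ⟨u, d, z, hu, hv | hv⟩)
  · exact D.Aset_subset hv
  · exact termUp_open hu hv
  · exact intFenceSetUp_subset ((D.fenceUp hu).F_subset hv)

/-- The connection of a fence from above avoids the arms. [folklore] -/
theorem fenceUp_disjoint_arm (D : IntPairDataB m N k₀ K T T' R₀ ω) {u : ℕ} {d : Finset (Site 2)} {z : Site 2}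
    (hu : (intDom m).flip.lowestSeq ω u = some (d, z)) {v : Site 2} (hv : v ∈ (D.fenceUp hu).F) : v ∉ D.armSet :=
  fun h => intFenceSetUp_disjoint ((D.fenceUp hu).F_subset hv) (Or.inr h)

/-- **The reach set for the enlarged admissible set.** [folklore] -/
def ReachB (D : IntPairDataB m N k₀ K T T' R₀ ω) (zz : Site 2) : Set (Site 2) :=
  {x | ∃ i, PathIn triGraph (D.AsetB \ {zz}) (D.b i) x}

/-- **`zz` is a cut for the enlarged admissible set.** [folklore] -/
def IsCutB (D : IntPairDataB m N k₀ K T T' R₀ ω) (zz : Site 2) : Prop :=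
  zz ∈ D.AsetB ∧
    (∀ (u : ℕ) (c : Finset (Site 2)) (z : Site 2) (hu : (intDom m).lowestSeq ω u = some (c, z)),
      (D.fence hu).m' ∉ D.ReachB zz) ∧
    (∀ (u : ℕ) (d : Finset (Site 2)) (z : Site 2) (hu : (intDom m).flip.lowestSeq ω u = some (d, z)),
      (D.fenceUp hu).m' ∉ D.ReachB zz)

/-- The smaller reach set is contained in the enlarged one. [folklore] -/
theorem reach_subset_reachB (D : IntPairDataB m N k₀ K T T' R₀ ω) (zz : Site 2) : D.Reach zz ⊆ D.ReachB zz := by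
  rintro x ⟨i, hp⟩
  exact ⟨i, hp.mono fun v hv => ⟨D.Aset_subset_AsetB hv.1, hv.2⟩⟩

/-- A cut for the enlarged set lying in the smaller set is a cut for the smaller set. [folklore] -/
theorem isCut_of_isCutB (D : IntPairDataB m N k₀ K T T' R₀ ω) {zz : Site 2} (h : D.IsCutB zz) (hzz : zz ∈ D.Aset) :
    D.IsCut zz :=
  ⟨hzz, fun u c z hu hm => h.2.1 u c z hu (D.reach_subset_reachB zz hm)⟩

/-- **A site of the arm `1` is not a cut for the enlarged set.** [cite: Nolin2008, §4.4 Lemma 15 (proof) (arXiv 0711.4948: Lemma 14, last paragraph)] -/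
theorem not_isCutB_of_mem_arm1 (D : IntPairDataB m N k₀ K T T' R₀ ω) {zz : Site 2} (hzz : zz ∈ (D.A 1).support) :
    ¬ D.IsCutB zz := fun h =>
  D.not_isCut_of_mem_arm1 hzz (D.isCut_of_isCutB h (D.armSet_subset_Aset (D.mem_armSet hzz)))

/-- Closure of the enlarged reach set under admissible paths. [folklore] -/
theorem reachB_of_pathIn (D : IntPairDataB m N k₀ K T T' R₀ ω) {zz x y : Site 2} (hx : x ∈ D.ReachB zz)
    (hp : PathIn triGraph (D.AsetB \ {zz}) x y) : y ∈ D.ReachB zz := by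
  obtain ⟨i, hpx⟩ := hx; exact ⟨i, hpx.trans hp⟩

/-! ### The minimal term from above -/

/-- Bookkeeping (`αF_isCrossingUp`). [folklore] -/
theorem αF_isCrossingUp (D : IntPairDataB m N k₀ K T T' R₀ ω) : (intDom m).flip.IsCrossing D.αF (D.y 0) :=
  (JDomain.flip_isCrossing_iff _).2 D.αF_isCrossing

/-- Bookkeeping (`exists_meetUp`). [folklore] -/
theorem exists_meetUp (D : IntPairDataB m N k₀ K T T' R₀ ω) :
    ∃ u, ∃ d z, (intDom m).flip.lowestSeq ω u = some (d, z) ∧ (D.αF ∩ d).Nonempty := by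
  obtain ⟨u, d, z, hu, hne⟩ := JDomain.exists_lowestSeq_inter_nonempty D.hcutUp D.αF_isCrossingUp D.αF_open
  exact ⟨u, d, z, hu, hne⟩

open Classical in
/-- **The minimal term from above of the arm `0`.** [cite: KestenPTM1982, §2.3 Prop. 2.3] -/
def uMinUp (D : IntPairDataB m N k₀ K T T' R₀ ω) : ℕ := Nat.find D.exists_meetUp

open Classical in
/-- Bookkeeping (`uMinUp_spec`). [folklore] -/
theorem uMinUp_spec (D : IntPairDataB m N k₀ K T T' R₀ ω) :
    ∃ d z, (intDom m).flip.lowestSeq ω D.uMinUp = some (d, z) ∧ (D.αF ∩ d).Nonempty :=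
  Nat.find_spec D.exists_meetUp

open Classical in
/-- Bookkeeping (`uMinUp_min`). [folklore] -/
theorem uMinUp_min (D : IntPairDataB m N k₀ K T T' R₀ ω) :
    ∀ v < D.uMinUp, ∀ d z, (intDom m).flip.lowestSeq ω v = some (d, z) → Disjoint D.αF d := by
  intro v hv d z h
  have := Nat.find_min D.exists_meetUp hv
  push Not at this
  exact Finset.disjoint_iff_inter_eq_empty.2 (this d z h)

/-- Bookkeeping (`αF_stageUp`). [folklore] -/
theorem αF_stageUp (D : IntPairDataB m N k₀ K T T' R₀ ω) :
    ∀ v d z, v + 1 = D.uMinUp → (intDom m).flip.lowestSeq ω v = some (d, z) →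
      D.αF ⊆ (intDom m).flip.above d z :=
  fun v d z hv h => JDomain.subset_above_of_forall_disjoint D.αF_isCrossingUp D.αF_open v
    (fun v' hv' d' z' h' => D.uMinUp_min v' (by omega) d' z' h') d z h

/-- Bookkeeping (`αF_meetUp`). [folklore] -/
theorem αF_meetUp (D : IntPairDataB m N k₀ K T T' R₀ ω) {d : Finset (Site 2)} {z : Site 2}
    (hu : (intDom m).flip.lowestSeq ω D.uMinUp = some (d, z)) : (D.αF ∩ d).Nonempty := by
  obtain ⟨d', z', hu', hne⟩ := D.uMinUp_spec
  rw [hu'] at hu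
  simp only [Option.some.injEq, Prod.mk.injEq] at hu
  obtain ⟨rfl, rfl⟩ := hu
  exact hne

/-- **The minimal term from above lies on or above the final crossing**: `d ⊆ flip.lower α`. [cite: KestenPTM1982, §2.3 Prop. 2.3] -/
theorem dMin_subset_flip_lower (D : IntPairDataB m N k₀ K T T' R₀ ω) {d : Finset (Site 2)} {z : Site 2}
    (hu : (intDom m).flip.lowestSeq ω D.uMinUp = some (d, z)) : d ⊆ (intDom m).flip.lower D.αF (D.y 0) :=
  JDomain.term_subset_lower D.hcutUp D.hdualUp hu D.αF_isCrossingUp D.αF_open D.αF_stageUp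

/-- **The minimal term from below lies on or below the final crossing**: `c ⊆ lower α`. [cite: KestenPTM1982, §2.3 Prop. 2.3] -/
theorem cMin_subset_lower (D : IntPairDataB m N k₀ K T T' R₀ ω) {c : Finset (Site 2)} {z : Site 2}
    (hu : (intDom m).lowestSeq ω D.uMin = some (c, z)) : c ⊆ (intDom m).lower D.αF (D.y 0) :=
  JDomain.term_subset_lower D.hcut D.hdual hu D.αF_isCrossing D.αF_open D.αF_stage

/-! ### The two canonical routes of the arm `0` -/

/-- **Route through the minimal term from below**, when its attachment site is reached from a
contact of `α` with `c` off `zz` (and `zz` off the connection): some start is joined to the fence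
site `m_c` in the enlarged admissible set off `zz`. [cite: Nolin2008, §4.4 Lemma 15 (proof) (arXiv 0711.4948: Lemma 14)] -/
theorem route_c (D : IntPairDataB m N k₀ K T T' R₀ ω) {c : Finset (Site 2)} {z : Site 2}
    (hu : (intDom m).lowestSeq ω D.uMin = some (c, z)) {zz : Site 2} (hzarm : zz ∉ D.armSet)
    (hzF : zz ∉ (D.fence hu).F)
    (h : (D.fence hu).q ∈ D.armSet ∨ ∃ x ∈ D.αF, x ∈ c ∧ PathIn triGraph ((↑c : Set (Site 2)) \ {zz}) x (D.fence hu).q) :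
    ∃ i, PathIn triGraph (D.AsetB \ {zz}) (D.b i) (D.fence hu).m' := by
  classical
  set Tf := D.fence hu
  have hqA := D.q_mem_Aset hu
  have hsub : D.Aset \ {zz} ⊆ D.AsetB \ {zz} := fun v hv => ⟨D.Aset_subset_AsetB hv.1, hv.2⟩
  rcases h with ⟨i', hq⟩ | ⟨x, hxα, hxc, hp⟩
  · have hzq : zz ≠ Tf.q := fun e => hzarm (by rw [e]; exact ⟨i', hq⟩)
    have h1 : PathIn triGraph (D.Aset \ {zz}) (D.b i') Tf.q :=
      D.pathIn_prefix i' hq fun h => hzarm (D.mem_armSet ((D.A i').support_takeUntil_subset_support hq h))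
    exact ⟨i', (h1.trans (D.pathIn_q_m hu hzF hzq hqA)).mono hsub⟩
  · have hzq : zz ≠ Tf.q := fun e => by rw [e] at hp; exact hp.right_mem.2 rfl
    have hxA : x ∈ (D.A 0).support := D.αF_subset x hxα
    have h1 : PathIn triGraph (D.Aset \ {zz}) (D.b 0) x :=
      D.pathIn_prefix 0 hxA fun h => hzarm (D.mem_armSet ((D.A 0).support_takeUntil_subset_support hxA h))
    have h2 : PathIn triGraph (D.Aset \ {zz}) x Tf.q := hp.mono fun v hv => ⟨D.term_subset_Aset hu hv.1, hv.2⟩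
    exact ⟨0, ((h1.trans h2).trans (D.pathIn_q_m hu hzF hzq hqA)).mono hsub⟩

/-- The attachment site of a fence from above is admissible. [folklore] -/
theorem qUp_mem_AsetB (D : IntPairDataB m N k₀ K T T' R₀ ω) {u : ℕ} {d : Finset (Site 2)} {z : Site 2}
    (hu : (intDom m).flip.lowestSeq ω u = some (d, z)) : (D.fenceUp hu).q ∈ D.AsetB := by
  rcases (D.fenceUp hu).q_mem with h | h
  · exact D.termUp_subset_AsetB hu h
  · exact D.Aset_subset_AsetB (D.armSet_subset_Aset h)

/-- **Route through the minimal term from above**, when not blocked. [cite: Nolin2008, §4.4 Lemma 15 (proof) (arXiv 0711.4948: Lemma 14)] -/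
theorem route_d (D : IntPairDataB m N k₀ K T T' R₀ ω) {d : Finset (Site 2)} {z : Site 2}
    (hu : (intDom m).flip.lowestSeq ω D.uMinUp = some (d, z)) {zz : Site 2} (hzarm : zz ∉ D.armSet)
    (hzF : zz ∉ (D.fenceUp hu).F)
    (h : (D.fenceUp hu).q ∈ D.armSet ∨ ∃ x ∈ D.αF, x ∈ d ∧ PathIn triGraph ((↑d : Set (Site 2)) \ {zz}) x (D.fenceUp hu).q) :
    ∃ i, PathIn triGraph (D.AsetB \ {zz}) (D.b i) (D.fenceUp hu).m' := by
  classical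
  set Tf := D.fenceUp hu
  have hqA := D.qUp_mem_AsetB hu
  have hsub : D.Aset \ {zz} ⊆ D.AsetB \ {zz} := fun v hv => ⟨D.Aset_subset_AsetB hv.1, hv.2⟩
  have hF : Tf.F ⊆ D.AsetB \ {zz} := fun v hv => ⟨D.fenceUp_subset_AsetB hu hv, fun e => hzF (e ▸ hv)⟩
  have hqm : zz ≠ Tf.q → PathIn triGraph (D.AsetB \ {zz}) Tf.q Tf.m' := fun hzq =>
    (PathIn.of_adj (show Tf.q ∈ D.AsetB \ {zz} from ⟨hqA, fun e => hzq (Set.mem_singleton_iff.1 e).symm⟩) (hF Tf.path.left_mem) Tf.adj).trans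
      (Tf.path.mono hF)
  rcases h with ⟨i', hq⟩ | ⟨x, hxα, hxd, hp⟩
  · have hzq : zz ≠ Tf.q := fun e => hzarm (by rw [e]; exact ⟨i', hq⟩)
    have h1 : PathIn triGraph (D.Aset \ {zz}) (D.b i') Tf.q :=
      D.pathIn_prefix i' hq fun h => hzarm (D.mem_armSet ((D.A i').support_takeUntil_subset_support hq h))
    exact ⟨i', (h1.mono hsub).trans (hqm hzq)⟩
  · have hzq : zz ≠ Tf.q := fun e => by rw [e] at hp; exact hp.right_mem.2 rfl
    have hxA : x ∈ (D.A 0).support := D.αF_subset x hxα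
    have h1 : PathIn triGraph (D.Aset \ {zz}) (D.b 0) x :=
      D.pathIn_prefix 0 hxA fun h => hzarm (D.mem_armSet ((D.A 0).support_takeUntil_subset_support hxA h))
    have h2 : PathIn triGraph (D.AsetB \ {zz}) x Tf.q := hp.mono fun v hv => ⟨D.termUp_subset_AsetB hu hv.1, hv.2⟩
    exact ⟨0, ((h1.mono hsub).trans h2).trans (hqm hzq)⟩

/-! ### No double block -/

/-- **The blocked side of a term, as a path off `α`.** If the removal of `zz ∈ e` (`zz ∉ α`)
separates, inside the crossing `e`, every contact of `α` from `q ∈ e`, then `zz` is joined to `q`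
inside `e` through sites off `α`. [folklore] -/
theorem exists_blocked_path (D : IntPairDataB m N k₀ K T T' R₀ ω) {e : Finset (Site 2)} {ze : Site 2}
    (he : (intDom m).IsCrossing e ze) {zz q : Site 2} (hze : zz ∈ e) (hqe : q ∈ e) (hzα : zz ∉ D.αF)
    (hblk : ∀ x ∈ D.αF, x ∈ e → ¬ PathIn triGraph ((↑e : Set (Site 2)) \ {zz}) x q) :
    PathIn triGraph ((↑e : Set (Site 2)) ∩ {v | v ∉ D.αF}) zz q := by
  by_cases hq : q = zz
  · subst hq; exact PathIn.refl ⟨Finset.mem_coe.2 hze, hzα⟩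
  set C := siteComp ((↑e : Set (Site 2)) \ {zz}) q with hC
  have hqC : q ∈ C := mem_siteComp_self ⟨Finset.mem_coe.2 hqe, hq⟩
  have hCsub : C ⊆ (↑e : Set (Site 2)) \ {zz} := siteComp_subset _ _
  have hCα : ∀ v ∈ C, v ∉ D.αF := fun v hv hvα =>
    hblk v hvα (Finset.mem_coe.1 (hCsub hv).1) (show PathIn triGraph ((↑e : Set (Site 2)) \ {zz}) v q from
      (pathIn_siteComp (show PathIn triGraph ((↑e : Set (Site 2)) \ {zz}) q v from hv)).symm.mono hCsub)
  -- `zz` is adjacent to `C`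
  obtain ⟨a, b, -, hb, -, hab, hpa⟩ := (he.conn q hqe zz hze).exit (R := {v : Site 2 | v ≠ zz}) hq (fun h => h rfl)
  have hb' : b = zz := by simpa using hb
  subst hb'
  have haC : a ∈ C := hpa.mono fun w hw => ⟨hw.2, hw.1⟩
  have hpath : PathIn triGraph C q a := pathIn_siteComp (hpa.mono fun w hw => ⟨hw.2, hw.1⟩)
  have hsub : C ∪ {b} ⊆ (↑e : Set (Site 2)) ∩ {v | v ∉ D.αF} := by
    rintro v (hv | hv)
    · exact ⟨(hCsub hv).1, hCα v hv⟩
    · rw [Set.mem_singleton_iff] at hv; subst hv; exact ⟨Finset.mem_coe.2 hze, hzα⟩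
  exact ((hpath.mono fun v hv => hsub (Or.inl hv)).trans
    (PathIn.of_adj (hsub (Or.inl haC)) (hsub (Or.inr rfl)) hab)).symm

/-- **Following the inner fence of the minimal term from below to the tip arc**: a path of
`D ∖ α` from the attachment site `q_c ∈ c`, off `α`, to a site `x` of the tip arc with
`z_c₁ ≤ x₁ ≤ z_c₁ + 2k + 1` and `x ∉ α`. [cite: KestenPTM1982, §2.3] -/
theorem exists_exit_c (D : IntPairDataB m N k₀ K T T' R₀ ω) {u : ℕ} {c : Finset (Site 2)} {zc : Site 2}
    (hu : (intDom m).lowestSeq ω u = some (c, zc)) (hqc : (D.fence hu).q ∈ c) (hqα : (D.fence hu).q ∉ D.αF) :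
    ∃ x : Site 2, x ∈ (intDom m).J ∧ zc 1 ≤ x 1 ∧ x 1 ≤ zc 1 + (2 * D.kOf hu + 1) ∧ x ∉ D.αF ∧
      PathIn triGraph ((↑(haFin m) : Set (Site 2)) ∩ {v | v ∉ D.αF}) (D.fence hu).q x := by
  have hc := term_isCrossing hu
  have hzcO := hc.tip_mem_J
  obtain ⟨hz0, hz1, hz2⟩ := tip_isIntJ' hu
  have hk := D.one_le_kOf hu
  have hk2 := D.two_le_kOf hu
  have hmid := D.tip_midOf hu
  have hkm := D.kOf_lt hu
  set Tf := D.fence hu with hTf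
  have hqD : Tf.q ∈ haFin m := hc.subset hqc
  by_cases hqz : Tf.q = zc
  · have key : ∀ w : Site 2, Tf.q = w → PathIn triGraph ((↑(haFin m) : Set (Site 2)) ∩ {v | v ∉ D.αF}) Tf.q w :=
      fun w hw => by subst hw; exact PathIn.refl ⟨Finset.mem_coe.2 hqD, hqα⟩
    refine ⟨zc, hzcO, le_rfl, by omega, fun h => hqα (by rw [hqz]; exact h), key zc hqz⟩
  have hpF := Tf.F_subset Tf.path.left_mem
  have hpbox := intFenceSet_box hpF
  have hqp := (triGraph_adj_iff_coord Tf.q Tf.p).1 Tf.adj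
  -- `p` is in the half-annulus
  have hpn : (m : ℤ) ≤ triNorm Tf.p := by
    by_contra hpn
    rw [not_le] at hpn
    have hrow := mem_intFenceSet_beyond hpF hpn
    have hqn : triNorm Tf.q = m := by
      have h1 := (mem_haFin.1 hqD).2.1
      have h2 := triNorm_le_triNorm_add_one_of_adj Tf.adj.symm
      omega
    have hq0 : Tf.q 0 = m := by
      have hqn' := hqn
      rw [triNorm_eq_max] at hqn'
      rcases hqp with h | h | h | h | h | h <;> omega
    have hq1 : zc 1 ≤ Tf.q 1 := by rcases hqp with h | h | h | h | h | h <;> omega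
    -- `q` is a site of `c` on the tip side above the row of `zc`: it is the tip
    have hqJ : Tf.q ∈ (intDom m).J := mem_intDom_J.2 ⟨hqD, ⟨hq0, by omega, by
      rcases hqp with h | h | h | h | h | h <;> omega⟩⟩
    exact hqz (hc.eq_tip _ hqc hqJ)
  obtain ⟨x', e, hx'n, hen, -, hadj, hpath⟩ := Tf.exists_exit hk (tip_isIntJ' hu) (by omega) Tf.path.left_mem hpn
  have hx'F : x' ∈ Tf.F := hpath.right_mem.2
  obtain ⟨hx'0, hlt, hle⟩ := Tf.exit_mem_Jabove D.hm hk hc (by omega) hx'F hx'n hen hadj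
  have hx'O : x' ∈ (intDom m).J :=
    mem_intDom_J.2 ⟨(mem_intFenceSet_inside (Tf.F_subset hx'F) hx'n).1, ⟨hx'0, by omega, by omega⟩⟩
  have hx'α : x' ∉ D.αF := fun h => D.fence_disjoint_arm hu hx'F (D.mem_armSet (D.αF_subset x' h))
  refine ⟨x', hx'O, hlt.le, hle, hx'α, ?_⟩
  have h1 : PathIn triGraph ((↑(haFin m) : Set (Site 2)) ∩ {v | v ∉ D.αF}) Tf.q Tf.p :=
    PathIn.of_adj ⟨Finset.mem_coe.2 hqD, hqα⟩
      ⟨Finset.mem_coe.2 (mem_intFenceSet_inside hpF hpn).1,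
        fun h => D.fence_disjoint_arm hu Tf.path.left_mem (D.mem_armSet (D.αF_subset _ h))⟩ Tf.adj
  exact h1.trans (hpath.mono fun v hv => ⟨Finset.mem_coe.2 (mem_intFenceSet_inside (Tf.F_subset hv.2) hv.1).1,
    fun h => D.fence_disjoint_arm hu hv.2 (D.mem_armSet (D.αF_subset _ h))⟩)

/-- **Following the inner fence of the minimal term from above to the tip arc**: a path of
`D ∖ α` from `q_d ∈ d`, off `α`, to a site `x` of the tip arc with `z_d₁ - (2k + 1) ≤ x₁ ≤ z_d₁`
and `x ∉ α`. [cite: KestenPTM1982, §2.3] -/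
theorem exists_exit_d (D : IntPairDataB m N k₀ K T T' R₀ ω) {u : ℕ} {d : Finset (Site 2)} {zd : Site 2}
    (hu : (intDom m).flip.lowestSeq ω u = some (d, zd)) (hqd : (D.fenceUp hu).q ∈ d) (hqα : (D.fenceUp hu).q ∉ D.αF) :
    ∃ x : Site 2, x ∈ (intDom m).J ∧ zd 1 - (2 * D.kOfUp hu + 1) ≤ x 1 ∧ x 1 ≤ zd 1 ∧ x ∉ D.αF ∧
      PathIn triGraph ((↑(haFin m) : Set (Site 2)) ∩ {v | v ∉ D.αF}) (D.fenceUp hu).q x := by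
  have hd := termUp_isCrossing hu
  have hdf := termUp_isCrossing' hu
  have hzdO : zd ∈ (intDom m).J := hd.tip_mem_J
  obtain ⟨hz0, hz1, hz2⟩ := tipUp_isIntJ hu
  have hk := D.one_le_kOfUp hu
  have hk2 := D.two_le_kOfUp hu
  have hmid := D.tipUp_mid hu
  have hkm := D.kOfUp_lt hu
  set Tf := D.fenceUp hu with hTf
  have hqD : Tf.q ∈ haFin m := hd.subset hqd
  by_cases hqz : Tf.q = zd
  · have key : ∀ w : Site 2, Tf.q = w → PathIn triGraph ((↑(haFin m) : Set (Site 2)) ∩ {v | v ∉ D.αF}) Tf.q w :=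
      fun w hw => by subst hw; exact PathIn.refl ⟨Finset.mem_coe.2 hqD, hqα⟩
    refine ⟨zd, hzdO, by omega, le_rfl, fun h => hqα (by rw [hqz]; exact h), key zd hqz⟩
  have hpF := Tf.F_subset Tf.path.left_mem
  have hpbox := intFenceSetUp_box hpF
  have hqp := (triGraph_adj_iff_coord Tf.q Tf.p).1 Tf.adj
  have hpn : (m : ℤ) ≤ triNorm Tf.p := by
    by_contra hpn
    rw [not_le] at hpn
    have hrow := mem_intFenceSetUp_beyond hpF hpn
    have hqn : triNorm Tf.q = m := by
      have h1 := (mem_haFin.1 hqD).2.1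
      have h2 := triNorm_le_triNorm_add_one_of_adj Tf.adj.symm
      omega
    have hq0 : Tf.q 0 = m := by
      have hqn' := hqn
      rw [triNorm_eq_max] at hqn'
      rcases hqp with h | h | h | h | h | h <;> omega
    have hqJ : Tf.q ∈ (intDom m).J := mem_intDom_J.2 ⟨hqD, ⟨hq0, by
      rcases hqp with h | h | h | h | h | h <;> omega, by omega⟩⟩
    exact hqz (hd.eq_tip _ hqd hqJ)
  obtain ⟨x', e, hen, hx'n, -, hadj, hpath⟩ := Tf.exists_exit_up hk (tipUp_isIntJ hu) (by omega) Tf.path.left_mem hpn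
  have hx'F : x' ∈ Tf.F := hpath.right_mem.2
  obtain ⟨hx'0, hle, hlt⟩ := Tf.exit_mem_Jbelow D.hm hk hdf (by omega) hx'F hx'n hen hadj
  have hx'O : x' ∈ (intDom m).J :=
    mem_intDom_J.2 ⟨(mem_intFenceSetUp_inside (Tf.F_subset hx'F) hx'n).1, ⟨hx'0, by omega, by omega⟩⟩
  have hx'α : x' ∉ D.αF := fun h => D.fenceUp_disjoint_arm hu hx'F (D.mem_armSet (D.αF_subset x' h))
  refine ⟨x', hx'O, hle, hlt.le, hx'α, ?_⟩
  have h1 : PathIn triGraph ((↑(haFin m) : Set (Site 2)) ∩ {v | v ∉ D.αF}) Tf.q Tf.p :=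
    PathIn.of_adj ⟨Finset.mem_coe.2 hqD, hqα⟩
      ⟨Finset.mem_coe.2 (mem_intFenceSetUp_inside hpF hpn).1,
        fun h => D.fenceUp_disjoint_arm hu Tf.path.left_mem (D.mem_armSet (D.αF_subset _ h))⟩ Tf.adj
  exact h1.trans (hpath.mono fun v hv => ⟨Finset.mem_coe.2 (mem_intFenceSetUp_inside (Tf.F_subset hv.2) hv.1).1,
    fun h => D.fenceUp_disjoint_arm hu hv.2 (D.mem_armSet (D.αF_subset _ h))⟩)

/-- **A site off `α` cannot block both exits of the arm `0`** (see the module docstring). [cite: Nolin2008, §4.4 Lemma 15 (proof) (arXiv 0711.4948: Lemma 14)] [cite: KestenPTM1982, §2.3 Prop. 2.3] -/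
theorem no_double_block (D : IntPairDataB m N k₀ K T T' R₀ ω) {c d : Finset (Site 2)} {zc zd : Site 2}
    (hu : (intDom m).lowestSeq ω D.uMin = some (c, zc)) (hu' : (intDom m).flip.lowestSeq ω D.uMinUp = some (d, zd))
    {zz : Site 2} (hzα : zz ∉ D.αF) (hzc : zz ∈ c) (hzd : zz ∈ d)
    (hqc : (D.fence hu).q ∈ c) (hqd : (D.fenceUp hu').q ∈ d)
    (hblk_c : ∀ x ∈ D.αF, x ∈ c → ¬ PathIn triGraph ((↑c : Set (Site 2)) \ {zz}) x (D.fence hu).q)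
    (hblk_d : ∀ x ∈ D.αF, x ∈ d → ¬ PathIn triGraph ((↑d : Set (Site 2)) \ {zz}) x (D.fenceUp hu').q) : False := by
  classical
  have hcut := D.hcut
  have hc := term_isCrossing hu
  have hd := termUp_isCrossing hu'
  have hα := D.αF_isCrossing
  have hαf := D.αF_isCrossingUp
  set y := D.y 0 with hy
  have hyO : y ∈ (intDom m).J := D.y_mem_J
  have hzzD : zz ∈ haFin m := hc.subset hzc
  have hzz_nabove : zz ∉ (intDom m).above D.αF y :=
    (JDomain.mem_lower_iff_not_mem_above hzzD).1 (D.cMin_subset_lower hu hzc)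
  have hzz_nfabove : zz ∉ (intDom m).flip.above D.αF y :=
    (JDomain.mem_lower_iff_not_mem_above (show zz ∈ (intDom m).flip.D from hzzD)).1 (D.dMin_subset_flip_lower hu' hzd)
  -- the two attachment sites are off `α` (they are in the blocked components)
  have hqcα : (D.fence hu).q ∉ D.αF := fun h => hblk_c _ h hqc (PathIn.refl ⟨Finset.mem_coe.2 hqc, fun e => ?_⟩)
  swap
  · -- `q_c = zz` would give `zz ∈ α`
    exact hzα (by rw [Set.mem_singleton_iff.1 e] at h; exact h)
  have hqdα : (D.fenceUp hu').q ∉ D.αF := fun h => hblk_d _ h hqd (PathIn.refl ⟨Finset.mem_coe.2 hqd, fun e => ?_⟩)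
  swap
  · exact hzα (by rw [Set.mem_singleton_iff.1 e] at h; exact h)
  -- paths `zz → q_c → x_c` and `zz → q_d → x_d` in `D ∖ α`
  set B : Set (Site 2) := (↑(haFin m) : Set (Site 2)) ∩ {v | v ∉ D.αF} with hB
  have hBD : B ⊆ (↑((intDom m).D \ D.αF) : Set (Site 2)) := fun v hv => by
    rw [Finset.coe_sdiff]; exact ⟨hv.1, hv.2⟩
  have pc : PathIn triGraph B zz (D.fence hu).q :=
    (D.exists_blocked_path hc hzc hqc hzα hblk_c).mono fun v hv => ⟨Finset.mem_coe.2 (hc.subset (Finset.mem_coe.1 hv.1)), hv.2⟩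
  have pd : PathIn triGraph B zz (D.fenceUp hu').q :=
    (D.exists_blocked_path hd hzd hqd hzα hblk_d).mono fun v hv => ⟨Finset.mem_coe.2 (hd.subset (Finset.mem_coe.1 hv.1)), hv.2⟩
  obtain ⟨xc, hxcO, hxc1, -, hxcα, pcx⟩ := D.exists_exit_c hu hqc hqcα
  obtain ⟨xd, hxdO, -, hxd2, hxdα, pdx⟩ := D.exists_exit_d hu' hqd hqdα
  have Pc : PathIn triGraph (↑((intDom m).D \ D.αF) : Set (Site 2)) zz xc := (pc.trans pcx).mono hBD
  have Pd : PathIn triGraph (↑((intDom m).D \ D.αF) : Set (Site 2)) zz xd := (pd.trans pdx).mono hBD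
  -- rows relative to the tip of `α`
  have hxcy : xc ≠ y := fun e => hxcα (e ▸ hα.tip_mem)
  have hxdy : xd ≠ y := fun e => hxdα (e ▸ hα.tip_mem)
  have hxc1' : xc 1 ≠ y 1 := fun e => hxcy (Site.eq_iff_two.2 ⟨(mem_intDom_J.1 hxcO).2.1.trans D.y_isIntJ.1.symm, e⟩)
  have hxd1' : xd 1 ≠ y 1 := fun e => hxdy (Site.eq_iff_two.2 ⟨(mem_intDom_J.1 hxdO).2.1.trans D.y_isIntJ.1.symm, e⟩)
  rcases lt_or_gt_of_ne hxc1' with hlt | hgt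
  · -- `x_c` strictly below the tip of `α`
    rcases lt_or_gt_of_ne hxd1' with hlt' | hgt'
    · -- `x_d` also below: `zz` would be joined to `J_{<y}` off `α`, i.e. flip-above `α`
      have hxd_fa : xd ∈ (intDom m).flip.above D.αF y :=
        hαf.mem_above_of_mem_Jabove (by rw [JDomain.flip_Jabove]; exact JDomain.mem_Jbelow.2 ⟨hxdO, by simpa using hlt'⟩)
      exact hzz_nfabove (JDomain.mem_above_of_pathIn' hxd_fa (by simpa using Pd.symm))
    · -- `x_d` above: a path off `α` from `J_{<y}` to `J_{>y}`
      exact hcut hα xc (Finset.mem_union_right _ (JDomain.mem_Jbelow.2 ⟨hxcO, by simpa using hlt⟩)) xd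
        (Finset.mem_union_right _ (JDomain.mem_Jabove.2 ⟨hxdO, by simpa using hgt'⟩)) (Pc.symm.trans Pd)
  · -- `x_c` strictly above the tip of `α`: `zz` would be above `α`
    have hxc_a : xc ∈ (intDom m).above D.αF y := hα.mem_above_of_mem_Jabove (JDomain.mem_Jabove.2 ⟨hxcO, by simpa using hgt⟩)
    exact hzz_nabove (JDomain.mem_above_of_pathIn' hxc_a Pc.symm)

end IntPairDataB

end Literature.Probability.Percolation
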